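import Literature.NumberTheory.GaloisRepresentations.LabelledWeightsDeRhamRank
import Literature.NumberTheory.GaloisRepresentations.OrdinaryTwistedDeterminant
import Literature.NumberTheory.PAdicHodge.FontaineDpstUnconditional
import HarnessLib

/-!
# A character which is a cyclotomic power on inertia is de Rham at `v ∣ p`, with one labelled weight

Topic `Literature/NumberTheory/PAdicHodge`; theorems only (no definition, no named fact, no instance).

Let `K` be a number field, `p` a prime, `v ∣ p` a place and `χ : Γ_K → ℚ̄_pˣ` a continuous
character whose restriction to the inertia group `I_{K_v}` of the completion (the tree's
`absInertia`, along `absGaloisRestrict K K_v`) is the `k`-th power of the cyclotomic character of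
`K_v`: `χ|_{Γ_{K_v}}` is an UNRAMIFIED TWIST OF `ε^k` — the local shape of the `p`-adic avatar at
`v ∣ p` of an algebraic Hecke character unramified at `v` (Serre 1968, Ch. III; for `K_v = ℚ_p` these
are exactly the crystalline characters, Brinon–Conrad Prop. 8.3.4).  Then, UNCONDITIONALLY for THE
pinned datum `fontainePstAdicCompletion v p hv` of the summit `Langlands` (whose period ring is the
construction `B_dR(K_v)`):

* `isLocallyUnramified_twist_inv_of_inertia_eq_cyclotomic_zpow` — `χ · 1 ⊗ ε^{-k}` is unramified
  on `Γ_{K_v}`;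
* `isDeRhamFramed_toLocal_scalar_comp_of_inertia_eq_cyclotomic_zpow` — the rank-one framed
  `χ · 1` is de Rham at `v` (accepted `fontainePstAdicCompletion_isDeRhamFramed_unramified_tateTwist`,
  Fontaine Exp. III Prop. 1.5.2: unramified ⊗ `ε^k` is `B_dR`-admissible);
* `exists_labelledHodgeTateWeightsAt_eq_singleton_of_inertia_eq_cyclotomic_zpow` — it has exactly
  one `τ`-labelled Hodge–Tate weight at every `ℚ_p`-label `τ : K_v → ℚ̄_p` (accepted
  `fontainePst_card_labelledHodgeTateWeights_eq`: a de Rham representation of rank `n` has `n`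
  labelled weights; Patrikis 2019 §2.7.1).

This is the bookkeeping that lets route statements phrase "`χ` algebraic above `p`" SYNTACTICALLY
(`χ|_{I_u} = ε_u^k`) and still feed consumers that want de Rham-ness and a single labelled weight
(e.g. crux `stmt-Langlands-17000`, line `symmetrise-pd-split`, waypoints 1–2).  The local `ε^k` is
packaged by `exists_continuousMonoidHom_eq_cyclotomic_zpow` in the `hε`-shape of the tree's
Tate-twist lemmas.

References: J.-M. Fontaine, Astérisque 223 (1994), Exp. III Prop. 1.5.2 [FontaineAsterisque223III];
S. Patrikis, *Variations on a theorem of Tate*, Mem. AMS 258 (2019), §2.7.1 [Patrikis2019];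
O. Brinon, B. Conrad, *CMI notes on p-adic Hodge theory* (2009), Prop. 8.3.4 [BrinonConrad2009];
J.-P. Serre, *Abelian ℓ-adic representations* (1968), Ch. III §1.1 [SerreAbelianLadic1968].
-/

noncomputable section

open scoped NumberField
open NumberField IsDedekindDomain Field
open Literature.NumberTheory.GaloisRepresentations

namespace Literature.NumberTheory.PAdicHodge

section Local

variable {p : ℕ} [Fact p.Prime]

/-- **The `k`-th power of the cyclotomic character of a field `L` as a continuous `ℚ̄_pˣ`-valued
character** (`zpowGroupHom k ∘ cyclotomicPadicAlgCl L p`), with its values in the `hε`-shape of the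
tree's Tate-twist lemmas (`(ε σ : ℚ̄_p) = (χ_p(σ) : ℚ_p)^k` pushed into `ℚ̄_p`,
accepted `coe_cyclotomicPadicAlgCl_apply`). [cite: SerreAbelianLadic1968, Ch. I §1.2] -/
theorem exists_continuousMonoidHom_eq_cyclotomic_zpow (L : Type) [Field L] (k : ℤ) :
    ∃ ε : absoluteGaloisGroup L →ₜ* (PadicAlgCl p)ˣ, ∀ σ, (ε σ : PadicAlgCl p) =
      (algebraMap ℚ_[p] (PadicAlgCl p)
        ((GaloisRep.cyclotomicCharacter L p σ : ℤ_[p]ˣ) : ℤ_[p])) ^ k := by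
  refine ⟨{ toMonoidHom := (zpowGroupHom k).comp (cyclotomicPadicAlgCl L p).toMonoidHom
            continuous_toFun := (continuous_zpow k).comp (cyclotomicPadicAlgCl L p).continuous },
    fun σ => ?_⟩
  change (((cyclotomicPadicAlgCl L p σ) ^ k : (PadicAlgCl p)ˣ) : PadicAlgCl p) = _
  rw [Units.val_zpow_eq_zpow_val, coe_cyclotomicPadicAlgCl_apply]

end Local

section NumberField

variable {K : Type} [Field K] [NumberField K] {p : ℕ} [Fact p.Prime]

/-- **Untwisting by `ε^{-k}` an inertially-cyclotomic character gives an unramified one.**  If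
`χ(σ) = ε(σ)^k` on `I_{K_v}` and `ε'` is any continuous character of `Γ_{K_v}` with the same values
`χ_p(σ)^k`, then `(χ · 1)|_{Γ_{K_v}} ⊗ ε'⁻¹` is unramified. [folklore] -/
theorem isLocallyUnramified_twist_inv_of_inertia_eq_cyclotomic_zpow
    (χ : absoluteGaloisGroup K →ₜ* (PadicAlgCl p)ˣ) (v : HeightOneSpectrum (𝓞 K)) (k : ℤ)
    (hχ : ∀ σ : absoluteGaloisGroup (v.adicCompletion K), σ ∈ absInertia (v.adicCompletion K) →
      ((χ (absGaloisRestrict K (v.adicCompletion K) σ) : (PadicAlgCl p)ˣ) : PadicAlgCl p) =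
        (algebraMap ℚ_[p] (PadicAlgCl p)
          ((GaloisRep.cyclotomicCharacter (v.adicCompletion K) p σ : ℤ_[p]ˣ) : ℤ_[p])) ^ k)
    (ε : absoluteGaloisGroup (v.adicCompletion K) →ₜ* (PadicAlgCl p)ˣ)
    (hε : ∀ σ, (ε σ : PadicAlgCl p) =
      (algebraMap ℚ_[p] (PadicAlgCl p)
        ((GaloisRep.cyclotomicCharacter (v.adicCompletion K) p σ : ℤ_[p]ˣ) : ℤ_[p])) ^ k) :
    ((FramedGaloisRep.toLocal v
        ((FramedRep.scalar (PadicAlgCl p) 1).comp χ : FramedGaloisRep K (PadicAlgCl p) 1)).twist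
      ε⁻¹).IsLocallyUnramified := by
  intro σ hσ
  have hunits : χ (absGaloisRestrict K (v.adicCompletion K) σ) = ε σ :=
    Units.ext (by rw [hχ σ hσ, hε σ])
  rw [FramedRep.twist_apply, FramedGaloisRep.toLocal_apply]
  change FramedRep.scalar (PadicAlgCl p) 1 (ε σ)⁻¹ *
      FramedRep.scalar (PadicAlgCl p) 1 (χ (absGaloisRestrict K (v.adicCompletion K) σ)) = 1
  rw [hunits, ← map_mul, inv_mul_cancel, map_one]

/-- **A character which is `ε^k` on inertia at `v ∣ p` is de Rham at `v` for THE pinned datum —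
unconditionally.**  `(χ · 1)|_{Γ_{K_v}} = ψ ⊗ ε^k` with `ψ` unramified
(`isLocallyUnramified_twist_inv_of_inertia_eq_cyclotomic_zpow`), and an unramified representation
twisted by a cyclotomic power is `B_dR(K_v)`-admissible
(`fontainePstAdicCompletion_isDeRhamFramed_unramified_tateTwist`).
[cite: FontaineAsterisque223III, Exp. III Prop. 1.5.2] [cite: BrinonConrad2009, Prop. 8.3.4] -/
theorem isDeRhamFramed_toLocal_scalar_comp_of_inertia_eq_cyclotomic_zpow
    (χ : absoluteGaloisGroup K →ₜ* (PadicAlgCl p)ˣ) (v : HeightOneSpectrum (𝓞 K))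
    (hv : ((p : ℕ) : 𝓞 K) ∈ v.asIdeal) (k : ℤ)
    (hχ : ∀ σ : absoluteGaloisGroup (v.adicCompletion K), σ ∈ absInertia (v.adicCompletion K) →
      ((χ (absGaloisRestrict K (v.adicCompletion K) σ) : (PadicAlgCl p)ˣ) : PadicAlgCl p) =
        (algebraMap ℚ_[p] (PadicAlgCl p)
          ((GaloisRep.cyclotomicCharacter (v.adicCompletion K) p σ : ℤ_[p]ˣ) : ℤ_[p])) ^ k) :
    (fontainePstAdicCompletion v p hv).IsDeRhamFramed
      (FramedGaloisRep.toLocal v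
        ((FramedRep.scalar (PadicAlgCl p) 1).comp χ : FramedGaloisRep K (PadicAlgCl p) 1)) := by
  obtain ⟨ε, hε⟩ := exists_continuousMonoidHom_eq_cyclotomic_zpow (p := p) (v.adicCompletion K) k
  have hψ := isLocallyUnramified_twist_inv_of_inertia_eq_cyclotomic_zpow χ v k hχ ε hε
  have hdR := fontainePstAdicCompletion_isDeRhamFramed_unramified_tateTwist v hv hψ k ε hε
  rwa [FramedRep.twist_twist, mul_inv_cancel, FramedRep.twist_one] at hdR

/-- **… and has exactly one labelled Hodge–Tate weight at every `ℚ_p`-label `τ : K_v → ℚ̄_p`** (for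
THE pinned datum's `ℚ_p`-structure and period ring): a de Rham representation of rank one has one
labelled weight (`fontainePst_card_labelledHodgeTateWeights_eq`).
[cite: Patrikis2019, §2.7.1] [cite: FontaineAsterisque223III, Exp. III Prop. 1.5.2] -/
theorem exists_labelledHodgeTateWeightsAt_eq_singleton_of_inertia_eq_cyclotomic_zpow
    (χ : absoluteGaloisGroup K →ₜ* (PadicAlgCl p)ˣ) (v : HeightOneSpectrum (𝓞 K))
    (hv : ((p : ℕ) : 𝓞 K) ∈ v.asIdeal) (k : ℤ)
    (hχ : ∀ σ : absoluteGaloisGroup (v.adicCompletion K), σ ∈ absInertia (v.adicCompletion K) →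
      ((χ (absGaloisRestrict K (v.adicCompletion K) σ) : (PadicAlgCl p)ˣ) : PadicAlgCl p) =
        (algebraMap ℚ_[p] (PadicAlgCl p)
          ((GaloisRep.cyclotomicCharacter (v.adicCompletion K) p σ : ℤ_[p]ˣ) : ℤ_[p])) ^ k) :
    letI := (fontainePstAdicCompletion v p hv).algebra
    ∀ τ : v.adicCompletion K →ₐ[ℚ_[p]] PadicAlgCl p, ∃ a : ℤ,
      FramedGaloisRep.labelledHodgeTateWeightsAt
        ((FramedRep.scalar (PadicAlgCl p) 1).comp χ : FramedGaloisRep K (PadicAlgCl p) 1) v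
        (fontainePstAdicCompletion v p hv).algebra (fontainePstAdicCompletion v p hv).𝔅 τ.toRingHom =
        {a} := by
  haveI := LocalField.charZero_adicCompletion v
  letI := (fontainePstAdicCompletion v p hv).algebra
  intro τ
  have hdR := isDeRhamFramed_toLocal_scalar_comp_of_inertia_eq_cyclotomic_zpow χ v hv k hχ
  have hcard := fontainePst_card_labelledHodgeTateWeights_eq
    (LocalField.valuation_adicCompletion_natCast_lt_one v p hv) hdR τ
  obtain ⟨a, ha⟩ := Multiset.card_eq_one.1 hcard
  refine ⟨a, ?_⟩
  rw [FramedGaloisRep.labelledHodgeTateWeightsAt_def]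
  exact ha

end NumberField

end Literature.NumberTheory.PAdicHodge
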